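import Literature.MathematicalPhysics.QuantumFieldTheory.Balaban1983to89.B6Cor28EntriesKLevelV1L0
import Literature.MathematicalPhysics.QuantumFieldTheory.Balaban1983to89.B6Cor28GradEntryKLevelV1L3
import Literature.MathematicalPhysics.QuantumFieldTheory.Balaban1983to89.B6QGQCoerciveKLevelV1L3
import HarnessLib

/-!
# `Balaban1983to89.B6Cor28EntriesKLevelV1L3` — SUB-ROW G-F3′-L0∕L3 (every odd `L ≥ 3`; plan `lit-balaban-r03/G-F3L0-PLAN.md` §13 cure (B′), joints J9′–J14): the L = 3 twin of
`B6Cor28EntriesKLevelV1L0` — ONLY its window-dependent assembly theorem is re-declared (joint J14: every window-free declaration of the level-0 twin is consumed BY NAME),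
re-proved verbatim over the L3 parents (canonical chart `B6CubeWindowV1L3`, placement predicate `PlacedC`, the binder `4 ≤ ℓ` DROPPED, `R ≥ 2L²` KEPT).
T. Bałaban, *Propagators and renormalization transformations for lattice gauge theories. II*, Commun. Math. Phys. **96** (1984) 223–250 [Balaban1984PropagatorsII].
No `def … : Prop`, no new fact; standard axioms.  Unit `lit-balaban-r03` (B6 fold owner, r03 gen 37), 2026-08-27; referee ref-4.  NOT summit progress.
ENDPOINT of the sub-row: Cor. 2.8 (2.151)₁,₂ hypothesis-free at k levels FOR EVERY ODD `L ≥ 3` — (2.147) now from `B6QGQCoerciveKLevelV1L3.qgq_coercive_kLevel` (`3 ≤ R·M̂`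
from `8 ≤ M̂`, `R ≥ 2L²`), and the specialisation `cor28_kLevel_H_DH_L3` (`L = 3`, `P′ ≥ 6`: every cube placed, `B6CubeWindowV1L3.placedC_all_cubes`).

statement-level skeleton of published theorems with citation tags; proofs where landed; nothing here is a claim about the Yang–Mills mass gap
-/

namespace Literature.MathematicalPhysics.QuantumFieldTheory.Balaban1983to89.B6Cor28EntriesKLevelV1L3

open scoped InnerProductSpace
open LatticeFieldCalculus
open B6SectAOperatorsV1 (QE QsE BondIdx BondIdxSpace)
open B6SectAVectorModelV1 (GE EE)
open B6Ineq2133TwoScaleV1 (onFun onFun_apply)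
open B6MultiLevelBoxOperator (N0)
open B6MultiLevelTorusOperatorL0 (TDomains)
open B6GlobalChartV1 (PV)
open B6GlobalChartV1L0 (domT blkV1)
open B6Geom246MultiLevelTorusL0 (geomT)
open B6Ineq2142KLevelV1L0 (lvl β qwt)
open B6Prop27KLevelV1L0 (lam card_fiber_beta_le wt)
open B6QGQCoerciveKLevelV1L3 (gam0 gam0_pos qgq_coercive_kLevel three_le_RMh)
open B6QGQCoerciveKLevelV1L0 (hwup_of_globalBand)
open B6GradLegKLevelV1 (DV)
open B6Cor28KLevelV1 (two_le_RMh)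
open B6Cor28KLevelV1L3 (cor28_kLevel_H_of_2147)
open B6Cor28GradEntryKLevelV1L3 (cor28_kLevel_H_DH_of_2147)
open B6RandomWalkHom (HasMajorantHom)
open B6CubeWindowV1 (Placed GlobalBand)
open B6Cover236MultiLevelBlocksL0 (cubes)
open B6CubeWindowV1L3 (PlacedC)

noncomputable section

variable {d ℓ m K : ℕ} {hd : 1 ≤ d + 1} {hL : Odd (ℓ + 1) ∧ 1 < ℓ + 1}
variable {Mh k R : ℕ} {P' : Fin (d + 1) → ℕ}

/-- **[B6] COROLLARY 2.8, THE ENTRY `|H(b, c)|` OF (2.151), AT k LEVELS FOR THE GENUINE `H = GQ*(QGQ*)⁻¹ = GE ∘ QsE ∘ EE`** on ROUTE V's V1 torus (binders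
of `B6QGQCoerciveKLevelV1L0.prop27_kLevel_unconditional` verbatim, the thresholds `M₂`, `N₁` enlarged): there are `σ₁ > 0` and, for every `σ ∈ (0, σ₁]`,
`α ∈ (0, 1)`, constants `δ₅ > 0`, `C ≥ 0`, `M₂ > 0`, `N₁` such that for every such torus family and weights in the band, for EVERY index bond `c` and
fine bond `f`: `|(He_c)(f)| ≤ C·e^{−δ₅·d_T(y(f), β c)}` (print: «|H(b,c)| ≤ O(1)(L^{j′}η)^{−d}e^{−δ₅d(y,c₋)}, b ∈ Δ(y), c₋ ∈ Λ_{j′}», the (2.150) weight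
`(L^{j(c)}η)^d` of the flat entry cancelling `(L^{j′}η)^{−d}`), AND `H` has the two-space majorant `2D·C·e^{−δ₅d_T}` between the index bonds (blocks `β`)
and the fine bonds (blocks `blkV1`).  `δ₅ = (15/32)·δ₄`, `δ₄ = min(δ₃/4, (γ₀/A′)/(16D·c/δ₃ + 1))` of W1/W3, `δ₃ = delta3 α (2σ)`.
[cite: Balaban1984PropagatorsII, Cor. 2.8 (2.150)–(2.151) p.249, Prop. 2.6 (2.136) p.247, Prop. 2.7 (2.149) p.249, Lemma 2.1 (2.60)–(2.63) p.234] -/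
theorem cor28_kLevel_H (d ℓ : ℕ) (hd : 1 ≤ d + 1) (hL : Odd (ℓ + 1) ∧ 1 < ℓ + 1) {b₀ b₁ : ℝ} (hb₀ : 0 < b₀) (hb₁ : b₀ ≤ b₁) :
    ∃ σ₁ : ℝ, 0 < σ₁ ∧ ∀ (σ : ℝ), 0 < σ → σ ≤ σ₁ → ∀ (α : ℝ), 0 < α → α < 1 →
    ∃ (δ₅ C M₂ : ℝ) (N₁ : ℕ), 0 < δ₅ ∧ 0 ≤ C ∧ 0 < M₂ ∧
    ∀ (m K : ℕ) {Mh k R : ℕ} {P' : Fin (d + 1) → ℕ}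
      (hN : ∀ μ, N0 ℓ Mh k P' μ = (PV d ℓ m K hd hL).sitesPerDir 0) (D : B6MultiLevelTorusOperatorL0.TDomains d ℓ Mh k P' R) (hk : k ≤ m + K) (_ : 2 ≤ k)
      {a : ℕ} (_ : Mh = (ℓ + 1) ^ a) (_ : 8 ≤ Mh) (_ : 2 * (ℓ + 1) ^ 2 ≤ R) (_ : ∀ μ, 5 ≤ P' μ)
      (_ : ∀ c : ↥(cubes D.toDomains), PlacedC ℓ k P' c.1) (_ : M₂ ≤ ((ℓ : ℝ) + 1) * Mh) (_ : N₁ + 1 ≤ R * ((ℓ + 1) * Mh))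
      {cf : ℝ} (hcf : cf ≠ 0) {w : BondIdx (domT hN D hk) → ℝ} (hw : ∀ i, 0 < w i) (_ : GlobalBand b₀ b₁ cf w),
      (∀ (c : BondIdx (domT hN D hk)) (f : PBond (PV d ℓ m K hd hL) 0),
        |(GE (domT hN D hk) hcf hw ∘ₗ QsE (domT hN D hk) ∘ₗ EE (domT hN D hk) hcf hw) (EuclideanSpace.single c (1 : ℝ)) f| ≤
          C * Real.exp (-(δ₅ * (geomT D).dist (blkV1 hN D f) (β hN D hk c)))) ∧
      HasMajorantHom (g := geomT D) (β hN D hk) (blkV1 hN D) (onFun (GE (domT hN D hk) hcf hw ∘ₗ QsE (domT hN D hk) ∘ₗ EE (domT hN D hk) hcf hw))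
        (fun y y' => 2 * ((d : ℝ) + 1) * C * Real.exp (-(δ₅ * (geomT D).dist y y'))) := by
  obtain ⟨σ₁, hσ₁, h⟩ := cor28_kLevel_H_of_2147 d ℓ hd hL hb₀ hb₁
  refine ⟨σ₁, hσ₁, fun σ hσ hσ1 α hα hα1 => ?_⟩
  have hb₁0 : 0 ≤ b₁ := hb₀.le.trans hb₁
  obtain ⟨δ₅, C, M₂, N₁, hδ₅, hC, hM₂, hH⟩ := h σ hσ hσ1 α hα hα1 (gam0 d ℓ b₁) (gam0_pos d ℓ hb₁0)
  refine ⟨δ₅, C, M₂, N₁, hδ₅, hC, hM₂, ?_⟩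
  intro m K Mh k R P' hN D hk hk2 a hMha hM8 hR2 hP5 hpl hM hRM cf hcf w hw hwb
  exact hH m K hN D hk hk2 hMha hM8 hR2 hP5 hpl hM hRM hcf hw hwb
    (qgq_coercive_kLevel hN D hk (three_le_RMh hR2 hM8) hcf hb₁0 hw (hwup_of_globalBand hN D hk hcf hwb))

/-- **[B6] COROLLARY 2.8, THE ENTRIES `|H(b, c)|` AND `|(∇H)(b, c)|` OF (2.151), AT k LEVELS FOR THE GENUINE `H = GQ*(QGQ*)⁻¹ = GE ∘ QsE ∘ EE`** on ROUTE V's V1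
torus, ONE set of constants (binders of `B6QGQCoerciveKLevelV1L0.prop27_kLevel_unconditional` verbatim, the thresholds `M₂`, `N₁` enlarged): there are `σ₁ > 0`
and, for every `σ ∈ (0, σ₁]`, `α ∈ (0, 1)`, constants `δ₅ > 0`, `C ≥ 0`, `M₂ > 0`, `N₁` such that for every such torus family and weights in the band, for EVERY
index bond `c`, fine bond `f` and direction `ν`: `|(He_c)(f)| ≤ C·e^{−δ₅·d_T(y(f), β c)}` and `|(∇_νHe_c)(f)| ≤ C·(L^{j(y(f))}η)^{−1}·e^{−δ₅·d_T(y(f), β c)}` (print: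
«|H(b,c)|, |(∇H)(b,c)| ≤ O(1)[1, (L^jη)^{−1}](L^{j′}η)^{−d}e^{−δ₅d(y,c₋)}, b ∈ Δ(y), y ∈ Λ_j, c₋ ∈ Λ_{j′}» with the (2.150) weight of the flat entries;
`(L^jη)^{−1} = (len(y)·|c_f|⁻¹)⁻¹`).  Inputs: p38's k-level (2.136)₁,₂ `prop26_2136_grad_kLevel_unconditional`, W1's (2.149) `prop27_kLevel_unconditional`.
[cite: Balaban1984PropagatorsII, Cor. 2.8 (2.150)–(2.151) p.249, Prop. 2.6 (2.136) p.247, Prop. 2.7 (2.149) p.249, Lemma 2.1 (2.60)–(2.63) p.234] -/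
theorem cor28_kLevel_H_DH (d ℓ : ℕ) (hd : 1 ≤ d + 1) (hL : Odd (ℓ + 1) ∧ 1 < ℓ + 1) {b₀ b₁ : ℝ} (hb₀ : 0 < b₀) (hb₁ : b₀ ≤ b₁) :
    ∃ σ₁ : ℝ, 0 < σ₁ ∧ ∀ (σ : ℝ), 0 < σ → σ ≤ σ₁ → ∀ (α : ℝ), 0 < α → α < 1 →
    ∃ (δ₅ C M₂ : ℝ) (N₁ : ℕ), 0 < δ₅ ∧ 0 ≤ C ∧ 0 < M₂ ∧
    ∀ (m K : ℕ) {Mh k R : ℕ} {P' : Fin (d + 1) → ℕ}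
      (hN : ∀ μ, N0 ℓ Mh k P' μ = (PV d ℓ m K hd hL).sitesPerDir 0) (D : B6MultiLevelTorusOperatorL0.TDomains d ℓ Mh k P' R) (hk : k ≤ m + K) (_ : 2 ≤ k)
      {a : ℕ} (_ : Mh = (ℓ + 1) ^ a) (_ : 8 ≤ Mh) (_ : 2 * (ℓ + 1) ^ 2 ≤ R) (_ : ∀ μ, 5 ≤ P' μ)
      (_ : ∀ c : ↥(cubes D.toDomains), PlacedC ℓ k P' c.1) (_ : M₂ ≤ ((ℓ : ℝ) + 1) * Mh) (_ : N₁ + 1 ≤ R * ((ℓ + 1) * Mh))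
      {cf : ℝ} (hcf : cf ≠ 0) {w : BondIdx (domT hN D hk) → ℝ} (hw : ∀ i, 0 < w i) (_ : GlobalBand b₀ b₁ cf w),
      (∀ (c : BondIdx (domT hN D hk)) (f : PBond (PV d ℓ m K hd hL) 0),
        |(GE (domT hN D hk) hcf hw ∘ₗ QsE (domT hN D hk) ∘ₗ EE (domT hN D hk) hcf hw) (EuclideanSpace.single c (1 : ℝ)) f| ≤
          C * Real.exp (-(δ₅ * (geomT D).dist (blkV1 hN D f) (β hN D hk c)))) ∧
      (∀ (ν : Fin (d + 1)) (c : BondIdx (domT hN D hk)) (f : PBond (PV d ℓ m K hd hL) 0),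
        |(DV ν cf ∘ₗ onFun (GE (domT hN D hk) hcf hw ∘ₗ QsE (domT hN D hk) ∘ₗ EE (domT hN D hk) hcf hw)) (Pi.single c 1) f| ≤
          C * ((geomT D).len (blkV1 hN D f) * |cf|⁻¹)⁻¹ * Real.exp (-(δ₅ * (geomT D).dist (blkV1 hN D f) (β hN D hk c)))) := by
  obtain ⟨σ₁, hσ₁, h⟩ := cor28_kLevel_H_DH_of_2147 d ℓ hd hL hb₀ hb₁
  refine ⟨σ₁, hσ₁, fun σ hσ hσ1 α hα hα1 => ?_⟩
  have hb₁0 : 0 ≤ b₁ := hb₀.le.trans hb₁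
  obtain ⟨δ₅, C, M₂, N₁, hδ₅, hC, hM₂, hH⟩ := h σ hσ hσ1 α hα hα1 (gam0 d ℓ b₁) (gam0_pos d ℓ hb₁0)
  refine ⟨δ₅, C, M₂, N₁, hδ₅, hC, hM₂, ?_⟩
  intro m K Mh k R P' hN D hk hk2 a hMha hM8 hR2 hP5 hpl hM hRM cf hcf w hw hwb
  exact hH m K hN D hk hk2 hMha hM8 hR2 hP5 hpl hM hRM hcf hw hwb
    (qgq_coercive_kLevel hN D hk (three_le_RMh hR2 hM8) hcf hb₁0 hw (hwup_of_globalBand hN D hk hcf hwb))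

/-- **COROLLARY 2.8 (2.151)₁,₂ AT k LEVELS, `L = 3`, `P′_μ ≥ 6`: THE PLACEMENT DISCHARGED** (at `L = 3` the canonical central chart places every cube,
`B6CubeWindowV1L3.placedC_all_cubes`), so that only print's setting ((2.2) `M` large, `R ≥ 2L²`; (2.16) the weight band; the V1 torus with `k ≥ 2`, `P′ ≥ 6`)
remains as hypotheses — the twin of `B6Line3CubeV1L3.prop26_2136_kLevel_unconditional_L5`. [cite: Balaban1984PropagatorsII, Cor. 2.8 (2.150)–(2.151) p.249, (2.2) p.224, (2.16) p.225] -/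
theorem cor28_kLevel_H_DH_L3 (d : ℕ) (hd : 1 ≤ d + 1) (hL : Odd (2 + 1) ∧ 1 < 2 + 1) {b₀ b₁ : ℝ} (hb₀ : 0 < b₀) (hb₁ : b₀ ≤ b₁) :
    ∃ σ₁ : ℝ, 0 < σ₁ ∧ ∀ (σ : ℝ), 0 < σ → σ ≤ σ₁ → ∀ (α : ℝ), 0 < α → α < 1 →
    ∃ (δ₅ C M₂ : ℝ) (N₁ : ℕ), 0 < δ₅ ∧ 0 ≤ C ∧ 0 < M₂ ∧
    ∀ (m K : ℕ) {Mh k R : ℕ} {P' : Fin (d + 1) → ℕ}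
      (hN : ∀ μ, N0 2 Mh k P' μ = (PV d 2 m K hd hL).sitesPerDir 0) (D : B6MultiLevelTorusOperatorL0.TDomains d 2 Mh k P' R) (hk : k ≤ m + K) (_ : 2 ≤ k)
      {a : ℕ} (_ : Mh = (2 + 1) ^ a) (_ : 8 ≤ Mh) (_ : 2 * (2 + 1) ^ 2 ≤ R) (_ : ∀ μ, 6 ≤ P' μ)
      (_ : M₂ ≤ (((2 : ℕ) : ℝ) + 1) * Mh) (_ : N₁ + 1 ≤ R * ((2 + 1) * Mh))
      {cf : ℝ} (hcf : cf ≠ 0) {w : BondIdx (domT hN D hk) → ℝ} (hw : ∀ i, 0 < w i) (_ : GlobalBand b₀ b₁ cf w),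
      (∀ (c : BondIdx (domT hN D hk)) (f : PBond (PV d 2 m K hd hL) 0),
        |(GE (domT hN D hk) hcf hw ∘ₗ QsE (domT hN D hk) ∘ₗ EE (domT hN D hk) hcf hw) (EuclideanSpace.single c (1 : ℝ)) f| ≤
          C * Real.exp (-(δ₅ * (geomT D).dist (blkV1 hN D f) (β hN D hk c)))) ∧
      (∀ (ν : Fin (d + 1)) (c : BondIdx (domT hN D hk)) (f : PBond (PV d 2 m K hd hL) 0),
        |(DV ν cf ∘ₗ onFun (GE (domT hN D hk) hcf hw ∘ₗ QsE (domT hN D hk) ∘ₗ EE (domT hN D hk) hcf hw)) (Pi.single c 1) f| ≤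
          C * ((geomT D).len (blkV1 hN D f) * |cf|⁻¹)⁻¹ * Real.exp (-(δ₅ * (geomT D).dist (blkV1 hN D f) (β hN D hk c)))) := by
  obtain ⟨σ₁, hσ₁, h⟩ := cor28_kLevel_H_DH d 2 hd hL hb₀ hb₁
  refine ⟨σ₁, hσ₁, fun σ hσ hσ1 α hα hα1 => ?_⟩
  obtain ⟨δ₅, C, M₂, N₁, hδ₅, hC, hM₂, h2⟩ := h σ hσ hσ1 α hα hα1
  refine ⟨δ₅, C, M₂, N₁, hδ₅, hC, hM₂, ?_⟩
  intro m K Mh k R P' hN D hk hk2 a hMha hM8 hR2 hP6 hM hRM cf hcf w hw hwb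
  exact h2 m K hN D hk hk2 hMha hM8 hR2 (fun μ => le_trans (by norm_num) (hP6 μ))
    (B6CubeWindowV1L3.placedC_all_cubes rfl hP6) hM hRM hcf hw hwb


end

end Literature.MathematicalPhysics.QuantumFieldTheory.Balaban1983to89.B6Cor28EntriesKLevelV1L3
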